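import Literature.Computability.QuantumComplexity.ProductStateExpectation
import Mathlib.Analysis.SpecialFunctions.Trigonometric.Basic
import HarnessLib

/-!
# The quantum kernel of the (tensor-)product encoding is the cosine kernel (Schuld–Killoran 2019)

Topic `Computability/QuantumComplexity`.  PUBLISHED RESULT with our proof; two small definitions
(the encoding) and NO named fact (D-0026).  Builds on the tree's
`ProductStateExpectation.lean` (`ProductState.productState`, inner products of product states
factorise).

HONEST FRAMING: instance-level adjudication of specific advantage claims; no claim about BQP vs BPP
or the summit.

## Source (read on the materialised text) and what is taken

M. Schuld, N. Killoran, *Quantum Machine Learning in Feature Hilbert Spaces*, Phys. Rev. Lett.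
**122**, 040504 (2019) = arXiv:1803.07128 [SchuldKilloran2019], §III ("Quantum machine learning in
feature Hilbert space"), paragraph *Product encoding* (held text `paper:arxiv-1803.07128`, chunk
p0006 L36–L42): "One can also use a (tensor) product encoding, in which each feature of the input
`x = (x_1, .., x_N)^T ∈ ℝ^N` is encoded in the amplitudes of one separate qubit. An example is to
encode … `U_φ : x ∈ ℝ^N → (cos x_1, sin x_1)^T ⊗ ⋯ ⊗ (cos x_N, sin x_N)^T ∈ ℝ^{2^N}`, … and implies a
cosine kernel, `κ(x, x′) = ∏_{i=1}^{N} cos(x_i − x′_i)`."  (Earlier in §III the paper defines the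
quantum kernel as the inner product of the feature states, `κ(x, x′) = ⟨φ(x)|φ(x′)⟩`.)

## What is formalised (qubits indexed by a finite type `ι`; a basis vector of `N = |ι|` qubits is a
## map `ι → Bool`, `false = |0⟩`, `true = |1⟩`, as in `ProductStateExpectation.lean`)

* `encodeQubit x = (cos x, sin x)` and `featureState x = ⊗_i encodeQubit (x i)` (defs);
* `encodeQubit_inner` — `⟨encodeQubit x | encodeQubit y⟩ = cos(x − y)`;
* **`featureState_inner`** — the printed statement: `⟨φ(x)|φ(x′)⟩ = ∏_i cos(x_i − x′_i)`;
* `featureState_inner_self` — normalisation `⟨φ(x)|φ(x)⟩ = 1`;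
* **`normSq_featureState_inner`** — the fidelity ("overlap-squared") kernel used by QSVM
  implementations: `|⟨φ(x)|φ(x′)⟩|² = ∏_i cos²(x_i − x′_i)`;
* `featureState_inner_half` — the half-angle convention `R_y(x)|0⟩ = (cos(x∕2), sin(x∕2))` of
  angle-encoding feature maps gives `∏_i cos((x_i − x′_i)∕2)` (substitution instance).

NOT formalised: kernels of entangling feature maps (ZZ / IQP maps), the RKHS formalism of §II, the
squeezing (continuous-variable) feature map of §III, any learning-theoretic statement.

Context (cell pub-qadeq, lane deq-2): an angle-encoded (product-encoded) "quantum kernel" is this closed-form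
classical cosine kernel, so a QSVM built on it is an ordinary SVM (CLAIMS rows A-1490, A-1491 and the
angle-encoding QSVM S-items); the lane cites this file for the identity instead of re-deriving it.
-/

noncomputable section

open Matrix

namespace Literature.Computability.QuantumComplexity.ProductEncodingKernel

open Literature.Computability.QuantumComplexity
open Literature.Computability.QuantumComplexity.ProductState

variable {ι : Type*} [Fintype ι] [DecidableEq ι]

/-- One feature in one qubit: amplitudes `(cos x, sin x)` on `|0⟩ = false`, `|1⟩ = true`.
[cite: SchuldKilloran2019, §III 'Product encoding' (the map `U_φ`)] -/
def encodeQubit (x : ℝ) : Bool → ℂ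
  | false => (Real.cos x : ℂ)
  | true => (Real.sin x : ℂ)

/-- The product feature state `|φ(x)⟩ = ⊗_i (cos x_i, sin x_i)ᵀ`.
[cite: SchuldKilloran2019, §III 'Product encoding' (the map `U_φ`)] -/
def featureState (x : ι → ℝ) : (ι → Bool) → ℂ := productState fun i => encodeQubit (x i)

omit [Fintype ι] [DecidableEq ι] in
/-- Unfolding lemmas. [cite: SchuldKilloran2019, §III 'Product encoding'] -/
theorem encodeQubit_false (x : ℝ) : encodeQubit x false = (Real.cos x : ℂ) := rfl

omit [Fintype ι] [DecidableEq ι] in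
/-- Unfolding lemmas. [cite: SchuldKilloran2019, §III 'Product encoding'] -/
theorem encodeQubit_true (x : ℝ) : encodeQubit x true = (Real.sin x : ℂ) := rfl

omit [DecidableEq ι] in
/-- Unfolding lemma: the amplitude of the basis vector `b` is `∏_i (cos x_i or sin x_i)`.
[cite: SchuldKilloran2019, §III 'Product encoding'] -/
theorem featureState_apply (x : ι → ℝ) (b : ι → Bool) :
    featureState x b = ∏ i, encodeQubit (x i) (b i) := rfl

omit [Fintype ι] [DecidableEq ι] in
/-- Single-qubit overlap: `⟨(cos x, sin x) | (cos y, sin y)⟩ = cos x cos y + sin x sin y = cos(x − y)`.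
[cite: SchuldKilloran2019, §III 'Product encoding'] -/
theorem encodeQubit_inner (x y : ℝ) :
    star (encodeQubit x) ⬝ᵥ encodeQubit y = (Real.cos (x - y) : ℂ) := by
  rw [dotProduct, Fintype.sum_bool]
  simp only [Pi.star_apply, encodeQubit_true, encodeQubit_false, Complex.star_def,
    Complex.conj_ofReal, Real.cos_sub]
  push_cast
  ring

/-- **The quantum kernel of the product encoding is the cosine kernel**:
`κ(x, x′) = ⟨φ(x)|φ(x′)⟩ = ∏_{i} cos(x_i − x′_i)`.
[cite: SchuldKilloran2019, §III 'Product encoding', displayed equation "implies a cosine kernel"] -/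
theorem featureState_inner (x y : ι → ℝ) :
    star (featureState x) ⬝ᵥ featureState y = ∏ i, (Real.cos (x i - y i) : ℂ) := by
  rw [featureState, featureState, star_productState_dotProduct_productState]
  exact Finset.prod_congr rfl fun i _ => encodeQubit_inner (x i) (y i)

/-- Normalisation of the feature state: `⟨φ(x)|φ(x)⟩ = ∏ cos 0 = 1`.
[cite: SchuldKilloran2019, §III 'Product encoding'] -/
theorem featureState_inner_self (x : ι → ℝ) :
    star (featureState x) ⬝ᵥ featureState x = 1 := by
  rw [featureState_inner]
  simp

/-- **Fidelity form of the kernel** (the overlap-squared used by QSVM implementations):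
`|⟨φ(x)|φ(x′)⟩|² = ∏_i cos²(x_i − x′_i)`. [cite: SchuldKilloran2019, §III 'Product encoding'
(immediate from the displayed cosine kernel)] -/
theorem normSq_featureState_inner (x y : ι → ℝ) :
    Complex.normSq (star (featureState x) ⬝ᵥ featureState y) = ∏ i, Real.cos (x i - y i) ^ 2 := by
  rw [featureState_inner]
  have h : (∏ i, (Real.cos (x i - y i) : ℂ)) = ((∏ i, Real.cos (x i - y i) : ℝ) : ℂ) := by
    push_cast; rfl
  rw [h, Complex.normSq_ofReal, ← sq, ← Finset.prod_pow]

/-- **Half-angle (angle-encoding) convention**: with `R_y(x)|0⟩ = (cos(x∕2), sin(x∕2))ᵀ` per feature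
the kernel is `∏_i cos((x_i − x′_i)∕2)` — the substitution instance of `featureState_inner`.
[cite: SchuldKilloran2019, §III 'Product encoding'] -/
theorem featureState_inner_half (x y : ι → ℝ) :
    star (featureState fun i => x i / 2) ⬝ᵥ featureState (fun i => y i / 2)
      = ∏ i, (Real.cos ((x i - y i) / 2) : ℂ) := by
  rw [featureState_inner]
  refine Finset.prod_congr rfl fun i _ => ?_
  rw [sub_div]

end Literature.Computability.QuantumComplexity.ProductEncodingKernel

end
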